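import Literature.Probability.LatticeModels.PlusStateFKG
import Literature.Probability.LatticeModels.IsingDecoration
import Literature.Probability.LatticeModels.LatticeLaplacianZd
import HarnessLib

/-!
# High-temperature lattice subharmonicity of the plus-state two-point function off the origin
# (crux `SubharmonicOffOrigin`, stmt-CriticalPhenomena-1341; line `SketchIdeator1`, by-product)

Registered sub-goal `highTemperature_subharmonicOffOrigin` of stmt-CriticalPhenomena-1341.  The crux
asks for `6·G(x) ≤ Σᵢ (G(x+eᵢ) + G(x−eᵢ))`, `x ≠ 0`, for the CRITICAL plus-state two-point function
`G = criticalTwoPoint 3` of `ℤ³` (open).  This file proves the one rigorous window of that inequality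
for the plus state `⟨·⟩⁺_β` of the nearest-neighbour Ising model on `ℤ^d`: for every `β ≥ 0` with
`d · tanh 2β ≤ 1` and every `x ≠ 0`,

  `2d · ⟨σ₀σ_x⟩⁺_β ≤ Σᵢ (⟨σ₀σ_{x+eᵢ}⟩⁺_β + ⟨σ₀σ_{x−eᵢ}⟩⁺_β)`

(`two_mul_mul_twoPointPlus_le_sum_nbrs`), and its `d = 3` instance `tanh 2β ≤ 1/3`
(`highTemperature_subharmonicOffOrigin`, the registered signature).  At `β_c(3)` one has
`tanh 2β_c ≈ 0.415 > 1/3`, so this does not touch the crux; it is the provable high-temperature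
companion recommended by the round-1 lead.

## Proof (DLR + FKG, Friedli–Velenik 2017, Lemma 6.7 and Thm. 3.21)

Fix `x ≠ 0`, a finite volume `Λ ∋ x` and a fixed boundary condition.  Write
`h_x(σ) = Σ_{y ∼ x} σ_y` (all `2d` lattice neighbours; boundary spins enter through the glued
configuration) and `K(σ) = h_x(σ) − 2d · tanh(β h_x(σ))`.
* HEAT BATH (one-site DLR identity, tree theorem `isingExpect_spinAt_mul_eq_tanh`): for `g` not
  reading `σ_x`, `⟨σ_x g⟩_Λ = ⟨tanh(β h_x) g⟩_Λ`.  With `g = 1` and `g = σ₀` (`x ≠ 0`):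
  `⟨K⟩_Λ = Σ_{y∼x} ⟨σ_y⟩_Λ − 2d ⟨σ_x⟩_Λ` and `⟨σ₀ K⟩_Λ = Σ_{y∼x} ⟨σ₀σ_y⟩_Λ − 2d ⟨σ₀σ_x⟩_Λ`.
* MONOTONICITY: `h_x` takes the values `2j`, `j ∈ ℤ ∩ [−d, d]`, and between consecutive such values
  `tanh(β·)` increases by at most `tanh 2β` (subadditivity `tanh(a+b) ≤ tanh a + tanh b` for
  `a, b ≥ 0`, and oddness; the steps never straddle `0`), so `d·tanh 2β ≤ 1` makes `K` nondecreasing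
  for the FKG order (`monotone_nbrSum_add_neg_mul_tanh`).
* FKG in finite volume (tree theorem `ising_fkg_holds`): `⟨σ₀⟩_Λ ⟨K⟩_Λ ≤ ⟨σ₀ K⟩_Λ`
  (`finiteVolume_fkg_heatBath`).
* LIMIT along the boxes `Λ_L` with plus boundary condition (tree theorems
  `hasBoxLimit_isingCorr_plus_holds`, `tendsto_isingTwoPoint_plus`,
  `plusExpect_spinAt_eq_spontaneousMagnetization_holds`): every one-point function tends to
  `m*(β)`, so `⟨K⟩_{Λ_L} → 2d·m* − 2d·m* = 0` and the left side tends to `0`, while the right side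
  tends to `Σ_{y∼x} ⟨σ₀σ_y⟩⁺ − 2d ⟨σ₀σ_x⟩⁺`; finally `Σ_{y∼x} = Σᵢ (· (x+eᵢ) + · (x−eᵢ))`
  (`sum_neighborFinset_zdGraph`).

References: S. Friedli, Y. Velenik, *Statistical Mechanics of Lattice Systems* (CUP 2017), Lemma 6.7
(one-site DLR / heat-bath kernel), Thm. 3.21 (FKG), Thm. 3.17 (plus state); H. B. Callen, Phys. Lett.
4 (1963) 161 (the identity `⟨σ_x⟩ = ⟨tanh β h_x⟩`).  No new definition, no named fact.
-/

noncomputable section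

open MeasureTheory Filter Topology Finset
open Literature.Probability.LatticeModels

namespace Summit.CriticalPhenomena.Ising3DConformalLimit.Theorems.PerfectScreening.Psk

/-! ### Elementary `tanh` estimates -/

/-- Subadditivity of `tanh` on `[0, ∞)` in increment form: `tanh (a + b) − tanh a ≤ tanh b` for
`a, b ≥ 0` (`tanh (a+b) − tanh a = sinh b / (cosh a · cosh (a+b))` and `cosh b ≤ cosh a · cosh (a+b)`). -/
private theorem tanh_add_sub_tanh_le {a b : ℝ} (ha : 0 ≤ a) (hb : 0 ≤ b) :
    Real.tanh (a + b) - Real.tanh a ≤ Real.tanh b := by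
  have hca : 0 < Real.cosh a := Real.cosh_pos a
  have hcab : 0 < Real.cosh (a + b) := Real.cosh_pos (a + b)
  have hcb : 0 < Real.cosh b := Real.cosh_pos b
  have hnum : Real.sinh (a + b) * Real.cosh a - Real.cosh (a + b) * Real.sinh a = Real.sinh b := by
    rw [← Real.sinh_sub, add_sub_cancel_left]
  have h1 : Real.tanh (a + b) - Real.tanh a = Real.sinh b / (Real.cosh (a + b) * Real.cosh a) := by
    rw [Real.tanh_eq_sinh_div_cosh, Real.tanh_eq_sinh_div_cosh, div_sub_div _ _ hcab.ne' hca.ne',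
      hnum]
  rw [h1, Real.tanh_eq_sinh_div_cosh]
  refine div_le_div_of_nonneg_left (Real.sinh_nonneg_iff.2 hb) hcb ?_
  calc Real.cosh b ≤ Real.cosh (a + b) := by
        refine Real.cosh_le_cosh.2 ?_
        rw [abs_of_nonneg hb, abs_of_nonneg (add_nonneg ha hb)]
        linarith
    _ ≤ Real.cosh (a + b) * Real.cosh a := le_mul_of_one_le_right hcab.le (Real.one_le_cosh a)

/-- One integer step: for `c ≥ 0` and every integer `k`, `tanh (c (k+1)) − tanh (c k) ≤ tanh c`
(for `k ≥ 0` by subadditivity; for `k ≤ −1` by oddness, the step then lying in `(−∞, 0]`). -/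
private theorem tanh_intStep_le {c : ℝ} (hc : 0 ≤ c) (k : ℤ) :
    Real.tanh (c * ((k : ℝ) + 1)) - Real.tanh (c * (k : ℝ)) ≤ Real.tanh c := by
  rcases le_or_gt 0 k with hk | hk
  · have hk' : (0 : ℝ) ≤ k := by exact_mod_cast hk
    have h := tanh_add_sub_tanh_le (mul_nonneg hc hk') hc
    rwa [show c * (k : ℝ) + c = c * ((k : ℝ) + 1) by ring] at h
  · have hk' : (k : ℝ) + 1 ≤ 0 := by
      have h1 : k + 1 ≤ 0 := by omega
      exact_mod_cast h1
    have h := tanh_add_sub_tanh_le (a := c * (-((k : ℝ) + 1))) (b := c)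
      (mul_nonneg hc (by linarith)) hc
    rw [show c * (-((k : ℝ) + 1)) + c = -(c * (k : ℝ)) by ring,
      show c * (-((k : ℝ) + 1)) = -(c * ((k : ℝ) + 1)) by ring, Real.tanh_neg, Real.tanh_neg] at h
    linarith

/-- `n` integer steps: for `c ≥ 0`, an integer `i` and `n : ℕ`,
`tanh (c (i + n)) − tanh (c i) ≤ n · tanh c`. -/
private theorem tanh_intSub_le {c : ℝ} (hc : 0 ≤ c) (i : ℤ) (n : ℕ) :
    Real.tanh (c * ((i : ℝ) + n)) - Real.tanh (c * (i : ℝ)) ≤ (n : ℝ) * Real.tanh c := by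
  induction n with
  | zero => simp
  | succ k ih =>
    have hstep := tanh_intStep_le hc (i + k)
    have e1 : ((i + k : ℤ) : ℝ) = (i : ℝ) + k := by push_cast; ring
    rw [e1] at hstep
    have e2 : (i : ℝ) + ((k + 1 : ℕ) : ℝ) = (i : ℝ) + k + 1 := by push_cast; ring
    rw [e2]
    push_cast
    linarith

/-! ### The FKG test function `K = h_x − 2n·tanh(β h_x)` is nondecreasing -/

/-- Parity bookkeeping: a sum of `±1` spins over `N` is `2 · #{y ∈ N | σ_y = +1} − #N`. -/
private theorem sum_spinAt_eq_two_mul_card_sub {V : Type*} (N : Finset V) (σ : SpinConfig V) :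
    ∑ y ∈ N, spinAt y σ = 2 * (#(N.filter fun y => σ y = 1) : ℝ) - #N := by
  have h : ∀ y ∈ N, spinAt y σ = 2 * (if σ y = 1 then (1 : ℝ) else 0) - 1 := fun y _ => by
    rw [← one_add_spinAt_div_two y σ]; ring
  rw [Finset.sum_congr rfl h, Finset.sum_sub_distrib, ← Finset.mul_sum, Finset.sum_boole,
    Finset.sum_const, nsmul_eq_mul, mul_one]

/-- **Monotonicity of the test function.** For a finite set `N` of `2n` sites, `β ≥ 0` and
`n · tanh 2β ≤ 1`, the function `σ ↦ h(σ) − 2n · tanh(β h(σ))`, `h(σ) = Σ_{y∈N} σ_y`, is nondecreasing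
for the coordinatewise order: `h` takes the values `2j` (`j ∈ ℤ`), raising `σ` raises `h` by `2k`
(`k ∈ ℕ`) and `tanh(β·)` by at most `k · tanh 2β ≤ k/n`. -/
private theorem monotone_nbrSum_add_neg_mul_tanh {V : Type*} (N : Finset V) {n : ℕ}
    (hN : #N = 2 * n) {β : ℝ} (hβ : 0 ≤ β) (hn : (n : ℝ) * Real.tanh (2 * β) ≤ 1) :
    Monotone fun σ : SpinConfig V =>
      (∑ y ∈ N, spinAt y σ) + -(2 * (n : ℝ)) * Real.tanh (β * ∑ y ∈ N, spinAt y σ) := by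
  intro σ τ hστ
  simp only
  have hS : ∑ y ∈ N, spinAt y σ ≤ ∑ y ∈ N, spinAt y τ :=
    Finset.sum_le_sum fun y _ => spinAt_mono y hστ
  obtain ⟨P, hP⟩ : ∃ P : ℕ, ∑ y ∈ N, spinAt y σ = 2 * ((P : ℝ) - n) :=
    ⟨#(N.filter fun y => σ y = 1), by
      rw [sum_spinAt_eq_two_mul_card_sub N σ, hN]; push_cast; ring⟩
  obtain ⟨Q, hQ⟩ : ∃ Q : ℕ, ∑ y ∈ N, spinAt y τ = 2 * ((Q : ℝ) - n) :=
    ⟨#(N.filter fun y => τ y = 1), by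
      rw [sum_spinAt_eq_two_mul_card_sub N τ, hN]; push_cast; ring⟩
  rw [hP, hQ] at hS ⊢
  have hPQ : P ≤ Q := by
    have : (P : ℝ) ≤ Q := by linarith
    exact_mod_cast this
  obtain ⟨k, rfl⟩ := Nat.exists_eq_add_of_le hPQ
  have hstep := tanh_intSub_le (c := 2 * β) (by linarith) ((P : ℤ) - n) k
  push_cast at hstep ⊢
  have e1 : β * (2 * ((P : ℝ) - n)) = 2 * β * ((P : ℝ) - n) := by ring
  have e2 : β * (2 * ((P : ℝ) + k - n)) = 2 * β * ((P : ℝ) - n + k) := by ring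
  rw [e1, e2]
  have hk : (0 : ℝ) ≤ k := Nat.cast_nonneg k
  have h3 : (k : ℝ) * ((n : ℝ) * Real.tanh (2 * β)) ≤ k * 1 := mul_le_mul_of_nonneg_left hn hk
  have h4 := mul_le_mul_of_nonneg_left hstep (by positivity : (0 : ℝ) ≤ 2 * n)
  nlinarith [h3, h4]

/-! ### The finite-volume inequality (heat bath + FKG) -/

/-- **Finite volume, fixed boundary condition.** For the nearest-neighbour Ising model on `ℤ^d` in a
finite volume `Λ ∋ x` with zero field and any fixed boundary condition `η`, `β ≥ 0`,
`d · tanh 2β ≤ 1` and `x ≠ 0`: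
`⟨σ₀⟩ · (Σ_{y∼x} ⟨σ_y⟩ − 2d ⟨σ_x⟩) ≤ Σ_{y∼x} ⟨σ₀σ_y⟩ − 2d ⟨σ₀σ_x⟩` (all expectations
`⟨·⟩^η_{Λ;β,0}`).  This is FKG (Friedli–Velenik 2017, Thm. 3.21; tree `ising_fkg_holds`) for the
nondecreasing pair `σ₀`, `K = h_x − 2d·tanh(β h_x)`, rewritten by the heat-bath identity
`⟨σ_x g⟩ = ⟨tanh(β h_x) g⟩` (Friedli–Velenik 2017, Lemma 6.7; tree `isingExpect_spinAt_mul_eq_tanh`)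
with `g = 1` and `g = σ₀`. -/
theorem finiteVolume_fkg_heatBath {d : ℕ} {β : ℝ} (hβ : 0 ≤ β)
    (hd : (d : ℝ) * Real.tanh (2 * β) ≤ 1) {x : Site d} (hx : x ≠ 0) {Λ : Finset (Site d)}
    (hxΛ : x ∈ Λ) (η : SpinConfig (Site d)) :
    isingExpect (zdGraph d) Λ β 0 (.fixed η) (spinAt 0) *
        (∑ y ∈ (zdGraph d).neighborFinset x, isingExpect (zdGraph d) Λ β 0 (.fixed η) (spinAt y) -
          2 * d * isingExpect (zdGraph d) Λ β 0 (.fixed η) (spinAt x)) ≤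
      ∑ y ∈ (zdGraph d).neighborFinset x, isingExpect (zdGraph d) Λ β 0 (.fixed η) (spinPair 0 y) -
        2 * d * isingExpect (zdGraph d) Λ β 0 (.fixed η) (spinPair 0 x) := by
  classical
  set N := (zdGraph d).neighborFinset x with hN
  have hcard : #N = 2 * d := card_neighborFinset_zdGraph_holds x
  -- the test function `K = h_x − 2d tanh(β h_x)` and its measurability / monotonicity
  set K : SpinConfig (Site d) → ℝ := fun σ =>
    (∑ y ∈ N, spinAt y σ) + -(2 * (d : ℝ)) * Real.tanh (β * ∑ y ∈ N, spinAt y σ) with hK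
  have hSm : Measurable fun σ : SpinConfig (Site d) => ∑ y ∈ N, spinAt y σ :=
    Finset.measurable_sum N fun y _ => measurable_spinAt y
  have hTm : Measurable fun σ : SpinConfig (Site d) => Real.tanh (β * ∑ y ∈ N, spinAt y σ) :=
    measurable_tanh_comp (hSm.const_mul β)
  have hTm' : Measurable fun σ : SpinConfig (Site d) =>
      -(2 * (d : ℝ)) * Real.tanh (β * ∑ y ∈ N, spinAt y σ) := hTm.const_mul _
  have hKm : Measurable K := hSm.add hTm'
  have hKmono : Monotone K := monotone_nbrSum_add_neg_mul_tanh N hcard hβ hd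
  -- FKG for the nondecreasing pair `σ₀`, `K`
  have hFKG := ising_fkg_holds (zdGraph d) hβ Λ 0 (.fixed η) (spinAt 0) K (spinAt_mono 0) hKmono
    (measurable_spinAt 0) hKm
  -- heat-bath identities with `g = 1` and `g = σ₀`
  have hb1 : isingExpect (zdGraph d) Λ β 0 (.fixed η)
      (fun σ => Real.tanh (β * ∑ y ∈ N, spinAt y σ)) =
      isingExpect (zdGraph d) Λ β 0 (.fixed η) (spinAt x) := by
    have h := isingExpect_spinAt_mul_eq_tanh (zdGraph d) hxΛ β η (g := fun _ => (1 : ℝ))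
      measurable_const (fun _ _ => rfl)
    simp only [mul_one] at h
    exact h.symm
  have hb2 : isingExpect (zdGraph d) Λ β 0 (.fixed η)
      (fun σ => Real.tanh (β * ∑ y ∈ N, spinAt y σ) * spinAt 0 σ) =
      isingExpect (zdGraph d) Λ β 0 (.fixed η) (spinPair 0 x) := by
    have h := isingExpect_spinAt_mul_eq_tanh (zdGraph d) hxΛ β η (g := spinAt 0)
      (measurable_spinAt 0) (fun σ u => by
        simp only [spinAt, Function.update_of_ne (Ne.symm hx)])
    rw [← h]
    congr 1
    funext σ
    rw [spinPair, mul_comm]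
  -- `⟨K⟩ = Σ_y ⟨σ_y⟩ − 2d ⟨σ_x⟩`
  have hEK : isingExpect (zdGraph d) Λ β 0 (.fixed η) K =
      ∑ y ∈ N, isingExpect (zdGraph d) Λ β 0 (.fixed η) (spinAt y) +
        -(2 * (d : ℝ)) * isingExpect (zdGraph d) Λ β 0 (.fixed η) (spinAt x) := by
    have h1 : isingExpect (zdGraph d) Λ β 0 (.fixed η) K =
        isingExpect (zdGraph d) Λ β 0 (.fixed η) (fun σ => ∑ y ∈ N, spinAt y σ) +
          isingExpect (zdGraph d) Λ β 0 (.fixed η)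
            (fun σ => -(2 * (d : ℝ)) * Real.tanh (β * ∑ y ∈ N, spinAt y σ)) :=
      isingExpect_add' (zdGraph d) Λ 0 (.fixed η) β hSm hTm'
    rw [h1, isingExpect_finset_sum' (zdGraph d) Λ 0 (.fixed η) β N spinAt fun y => measurable_spinAt y,
      isingExpect_const_mul' (zdGraph d) Λ 0 (.fixed η) β _ hTm, hb1]
  -- `⟨σ₀ K⟩ = Σ_y ⟨σ₀σ_y⟩ − 2d ⟨σ₀σ_x⟩`
  have hE0K : isingExpect (zdGraph d) Λ β 0 (.fixed η) (spinAt 0 * K) =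
      ∑ y ∈ N, isingExpect (zdGraph d) Λ β 0 (.fixed η) (spinPair 0 y) +
        -(2 * (d : ℝ)) * isingExpect (zdGraph d) Λ β 0 (.fixed η) (spinPair 0 x) := by
    have hfun : spinAt 0 * K = fun σ => (∑ y ∈ N, spinPair 0 y σ) +
        -(2 * (d : ℝ)) * (Real.tanh (β * ∑ y ∈ N, spinAt y σ) * spinAt 0 σ) := by
      funext σ
      simp only [Pi.mul_apply, hK, spinPair, mul_add, Finset.mul_sum]
      ring
    have hPm : Measurable fun σ : SpinConfig (Site d) => ∑ y ∈ N, spinPair 0 y σ :=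
      Finset.measurable_sum N fun y _ => measurable_spinPair 0 y
    have hTm0 : Measurable fun σ : SpinConfig (Site d) =>
        Real.tanh (β * ∑ y ∈ N, spinAt y σ) * spinAt 0 σ := hTm.mul (measurable_spinAt 0)
    rw [hfun, isingExpect_add' (zdGraph d) Λ 0 (.fixed η) β hPm (hTm0.const_mul _),
      isingExpect_finset_sum' (zdGraph d) Λ 0 (.fixed η) β N (fun y => spinPair 0 y)
        fun y => measurable_spinPair 0 y,
      isingExpect_const_mul' (zdGraph d) Λ 0 (.fixed η) β _ hTm0, hb2]
  rw [hEK, hE0K] at hFKG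
  linarith

/-! ### Passage to the plus state along boxes -/

/-- **High-temperature lattice subharmonicity of the plus-state two-point function off the origin,
general dimension.** For the nearest-neighbour Ising model on `ℤ^d`, `β ≥ 0` with `d · tanh 2β ≤ 1`
and `x ≠ 0`: `2d · ⟨σ₀σ_x⟩⁺_β ≤ Σᵢ (⟨σ₀σ_{x+eᵢ}⟩⁺_β + ⟨σ₀σ_{x−eᵢ}⟩⁺_β)`.  Limit `L → ∞` of
`finiteVolume_fkg_heatBath` in the boxes `Λ_L` with plus boundary condition: all one-point functions
tend to `m*(β)` (translation invariance of the plus state, Friedli–Velenik 2017, Thm. 3.17), so the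
left side tends to `m* · (2d m* − 2d m*) = 0`, and the two-point functions tend to `⟨σ₀σ_·⟩⁺_β`. -/
theorem two_mul_mul_twoPointPlus_le_sum_nbrs {d : ℕ} {β : ℝ} (hβ : 0 ≤ β)
    (hd : (d : ℝ) * Real.tanh (2 * β) ≤ 1) {x : Site d} (hx : x ≠ 0) :
    2 * d * twoPointPlus d β x ≤
      ∑ i : Fin d, (twoPointPlus d β (x + Pi.single i 1) + twoPointPlus d β (x - Pi.single i 1)) := by
  classical
  -- one-point functions along plus boxes converge to `m*(β)`
  have hone : ∀ z : Site d, Tendsto (fun L : ℕ => isingExpect (zdGraph d) (box d L) β 0 .plus (spinAt z))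
      atTop (𝓝 (spontaneousMagnetization d β)) := by
    intro z
    have h : Tendsto (fun L : ℕ => isingCorr (zdGraph d) (box d L) β 0 .plus {z}) atTop
        (𝓝 (plusCorr d β 0 {z})) := hasBoxLimit_isingCorr_plus_holds (d := d) hβ le_rfl {z}
    have h' : plusCorr d β 0 {z} = spontaneousMagnetization d β := by
      rw [plusCorr, spinProduct_singleton]
      exact plusExpect_spinAt_eq_spontaneousMagnetization_holds hβ z
    simp only [isingCorr, spinProduct_singleton, h'] at h
    exact h
  -- two-point functions along plus boxes converge to `⟨σ₀σ_z⟩⁺`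
  have htwo : ∀ z : Site d, Tendsto (fun L : ℕ => isingExpect (zdGraph d) (box d L) β 0 .plus (spinPair 0 z))
      atTop (𝓝 (twoPointPlus d β z)) := fun z =>
    tendsto_isingTwoPoint_plus hasBoxLimit_isingCorr_plus_holds hβ z
  set N := (zdGraph d).neighborFinset x with hN
  -- the finite-volume inequality holds as soon as `x ∈ Λ_L`
  have hev : ∀ᶠ L : ℕ in atTop,
      isingExpect (zdGraph d) (box d L) β 0 .plus (spinAt 0) *
          (∑ y ∈ N, isingExpect (zdGraph d) (box d L) β 0 .plus (spinAt y) -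
            2 * d * isingExpect (zdGraph d) (box d L) β 0 .plus (spinAt x)) ≤
        ∑ y ∈ N, isingExpect (zdGraph d) (box d L) β 0 .plus (spinPair 0 y) -
          2 * d * isingExpect (zdGraph d) (box d L) β 0 .plus (spinPair 0 x) := by
    filter_upwards [eventually_mem_box x] with L hL
    exact finiteVolume_fkg_heatBath hβ hd hx hL 1
  have hlim1 := (hone 0).mul
    ((tendsto_finsetSum N fun y _ => hone y).sub ((hone x).const_mul (2 * (d : ℝ))))
  have hlim2 := (tendsto_finsetSum N fun y _ => htwo y).sub ((htwo x).const_mul (2 * (d : ℝ)))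
  have hle := le_of_tendsto_of_tendsto hlim1 hlim2 hev
  have hzero : spontaneousMagnetization d β *
      (∑ _y ∈ N, spontaneousMagnetization d β - 2 * (d : ℝ) * spontaneousMagnetization d β) = 0 := by
    rw [Finset.sum_const, hN, card_neighborFinset_zdGraph_holds x, nsmul_eq_mul]
    push_cast
    ring
  rw [hzero, hN, sum_neighborFinset_zdGraph (twoPointPlus d β) x] at hle
  linarith

/-- **Registered by-product stub `highTemperature_subharmonicOffOrigin` of the crux
`SubharmonicOffOrigin` (stmt-CriticalPhenomena-1341): the crux inequality for the plus state of `ℤ³`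
at HIGH temperature.** For every `β ≥ 0` with `tanh 2β ≤ 1/3` and every `x ≠ 0`,
`6 · ⟨σ₀σ_x⟩⁺_β ≤ Σᵢ (⟨σ₀σ_{x+eᵢ}⟩⁺_β + ⟨σ₀σ_{x−eᵢ}⟩⁺_β)` — the case `d = 3` of
`two_mul_mul_twoPointPlus_le_sum_nbrs` (DLR heat bath + FKG; Friedli–Velenik 2017, Lemma 6.7 and
Thm. 3.21).  The window stops short of `β_c(3)` (`tanh 2β_c ≈ 0.415`). -/
theorem highTemperature_subharmonicOffOrigin : ∀ β : ℝ, 0 ≤ β → Real.tanh (2 * β) ≤ 1 / 3 → ∀ x : Site 3, x ≠ 0 → 6 * twoPointPlus 3 β x ≤ ∑ i : Fin 3, (twoPointPlus 3 β (x + Pi.single i 1) + twoPointPlus 3 β (x - Pi.single i 1)) := by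
  intro β hβ hβt x hx
  have hd : ((3 : ℕ) : ℝ) * Real.tanh (2 * β) ≤ 1 := by
    push_cast
    linarith
  have h := two_mul_mul_twoPointPlus_le_sum_nbrs hβ hd hx
  push_cast at h
  linarith

end Summit.CriticalPhenomena.Ising3DConformalLimit.Theorems.PerfectScreening.Psk

end
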